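import Mathlib.Topology.Algebra.ClopenNhdofOne
import Literature.IUT.HodgeTheaters.TemperedCoveringsProofs
import HarnessLib

/-!
# [IUTchI] §2: the verticial / pro-`Σ`-Sylow steps of Prop. 2.2 and Prop. 2.4 (iii) (pp. 45, 51), PROOFS

Mochizuki, *Inter-universal Teichmüller theory I: construction of Hodge theaters*, kurims
manuscript (May 2020), §2 [cite: Mochizuki2012, §2 pp.45-51] (D-0012 claim key; series status
DISPUTED).  PROOF-ONLY companion of `Literature.IUT.HodgeTheaters.TemperedCoverings`
(abc-iut-L5-t1), continuing `TemperedCoveringsProofs`; no definitions.  The two printed sentences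
kernel-checked here, over ARBITRARY data `D`, are "by allowing, in Proposition 2.1, `Λ` to range
over the open subgroups of any verticial [hence, in particular, nontrivial compact!] subgroup of
`Π^tp_𝔾`, we conclude from Proposition 2.1 that `Π^tp_𝔾` is commensurably terminal in `Π̂_𝔾`" (proof
of Prop. 2.2, p. 45) and "the commensurable terminality of `Δ^tp_X` in `Δ̂_X` follows immediately
from assertion (i), by allowing, in assertion (i), `Λ` to range over the open subgroups of a pro-`Σ`
Sylow subgroup of a decomposition group `⊆ Δ^tp_X` associated to an irreducible component of the
special fiber" (proof of Prop. 2.4 (iii), p. 51), in two forms: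
* with the verticial / Sylow subgroup `V` entering as in print via "(O3) every finite index
  subgroup of `H` is open in `H`" (Rmk. 2.5.3 (iii), p. 56, [NS]) —
  `StableCurveTemperedData.delta_isCommensurablyTerminal_of_prop24i`, `….prop24iii_of_prop24i`
  (the Prop. 2.2 version is `TemperedGraphGroupData.tp_isCommensurablyTerminal_of_prop21` in
  `TemperedCoveringsProofs`);
* with an ELEMENTARY replacement of [NS] (`exists_compact_le_inf_of_finiteIndex`: in a Hausdorff
  group, an infinite compact `V` meets every finite index subgroup in a set containing a
  nontrivial compact subgroup — `⟨c⟩` or the closure of `⟨c^m⟩`), so that `V` need only be an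
  infinite compact (resp. infinite profinite pro-`Σ`) subgroup —
  `TemperedGraphGroupData.tp_isCommensurablyTerminal_of_prop21'`, `….prop22_of_prop21'`,
  `StableCurveTemperedData.delta_isCommensurablyTerminal_of_prop24i'`, `….prop24iii_of_prop24i'`.
Pro-`Σ` (= `Literature.AnabelianGeometry.SemiGraphs.IsProSigma`, as in the statement file) tools:
`isProSigma_of_surjective` (continuous homomorphic images), `isProSigma_subgroup_of_isOpen` (open
subgroups of compact groups), `isProSigma_subgroup` (arbitrary subgroups of profinite groups).
-/

namespace Literature.IUT.HodgeTheaters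

open Pointwise Topology
open Literature.AnabelianGeometry.AbsoluteAnabelian (IsCommensurablyTerminal IsNormallyTerminal)
open Literature.AnabelianGeometry.SemiGraphs (IsProSigma)

universe u

/-! ### Compact subgroups inside finite index subgroups — without [NS] (pp. 45, 51) -/

section Elementary

/-- **"The open subgroups of a verticial subgroup", elementary form.**  In a Hausdorff topological
group `T`, let `V` be an infinite compact subgroup and `N ⊆ T` a subgroup of finite index.  Then
`V ∩ N` contains a nontrivial compact subgroup `Λ`.  [No hypothesis "finite index subgroups of `V`
are open" ((O3), p. 56, [NS]) is needed: for `c ∈ V ∩ N`, `c ≠ 1`, take `Λ = ⟨c⟩` if `c` has finite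
order, and otherwise `Λ =` the closure of `⟨c^m⟩`, `m = [V : V ∩ N]!`, which lies in the compact set
of `m`-th powers of the closure of `⟨c⟩`, a subset of `N`.]  This is what the proofs of Prop. 2.2
(p. 45) and Prop. 2.4 (iii) (p. 51) need from a verticial subgroup.
[cite: Mochizuki2012, Prop 2.2 p.45] -/
theorem exists_compact_le_inf_of_finiteIndex {T : Type*} [Group T] [TopologicalSpace T]
    [IsTopologicalGroup T] [T2Space T] {V : Subgroup T} (hVc : IsCompact (V : Set T))
    (hVinf : (V : Set T).Infinite) (N : Subgroup T) [hN : N.FiniteIndex] :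
    ∃ Λ : Subgroup T, Λ ≤ V ⊓ N ∧ IsCompact (Λ : Set T) ∧ Λ ≠ ⊥ := by
  set K : Subgroup V := N.subgroupOf V with hK
  -- `V ∩ N` is infinite, being of finite index in the infinite group `V`: pick `c ≠ 1` in it
  have hKinf : (K : Set V).Infinite := by
    intro hfin
    haveI : Finite K := hfin.to_subtype
    haveI : Infinite V := Set.infinite_coe_iff.mpr hVinf
    have hidx := Subgroup.card_mul_index K
    rw [Nat.card_eq_zero_of_infinite (α := V)] at hidx
    exact (Subgroup.instFiniteIndex_subgroupOf N V).index_ne_zero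
      ((Nat.mul_eq_zero.mp hidx).resolve_left Nat.card_pos.ne')
  obtain ⟨c, hc, hc1⟩ : ∃ c : T, c ∈ V ⊓ N ∧ c ≠ 1 := by
    by_contra hcon
    push Not at hcon
    apply hKinf
    refine (Set.finite_singleton (1 : V)).subset fun k hk => ?_
    have hk1 : (k : T) = 1 := hcon k ⟨k.2, hk⟩
    exact Subtype.ext hk1
  by_cases hfin : IsOfFinOrder c
  · -- finite order: `Λ = ⟨c⟩`, a finite subgroup
    haveI : Finite (Subgroup.zpowers c) := Finite.of_equiv _ (finEquivZPowers hfin)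
    refine ⟨Subgroup.zpowers c, Subgroup.zpowers_le.mpr hc, (Set.toFinite _).isCompact, ?_⟩
    rwa [Ne, Subgroup.zpowers_eq_bot]
  · -- infinite order: `m := [V : V ∩ N]!` kills `V` into `N`
    set m : ℕ := K.index.factorial with hm
    have hpow : ∀ v ∈ V, v ^ m ∈ N := by
      intro v hv
      obtain ⟨n, hn0, hnle, hvn⟩ := K.exists_pow_mem_of_index_ne_zero
        (Subgroup.instFiniteIndex_subgroupOf N V).index_ne_zero ⟨v, hv⟩
      have hvn' : v ^ n ∈ N := hvn
      obtain ⟨k, hk⟩ := Nat.dvd_factorial hn0 hnle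
      rw [hm, hk, pow_mul]
      exact N.pow_mem hvn' k
    -- `Z := cl ⟨c⟩ ⊆ V` is compact; so is the set of its `m`-th powers, which lies in `N`
    set Z : Subgroup T := (Subgroup.zpowers c).topologicalClosure with hZ
    have hZV : Z ≤ V :=
      Subgroup.topologicalClosure_minimal _ (Subgroup.zpowers_le.mpr hc.1) hVc.isClosed
    have hZc : IsCompact (Z : Set T) :=
      hVc.of_isClosed_subset (Subgroup.isClosed_topologicalClosure _) hZV
    have hPc : IsCompact ((fun z : T => z ^ m) '' (Z : Set T)) := hZc.image (continuous_pow m)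
    -- `Λ := cl ⟨c ^ m⟩` lies in that set
    have hsub : ((Subgroup.zpowers (c ^ m)).topologicalClosure : Set T) ⊆
        (fun z : T => z ^ m) '' (Z : Set T) := by
      rw [Subgroup.topologicalClosure_coe]
      refine closure_minimal (fun x hx => ?_) hPc.isClosed
      obtain ⟨k, rfl⟩ := Subgroup.mem_zpowers_iff.mp hx
      refine ⟨c ^ k, Subgroup.le_topologicalClosure _ (Subgroup.zpow_mem_zpowers c k), ?_⟩
      show (c ^ k) ^ m = (c ^ m) ^ k
      rw [← zpow_natCast, ← zpow_mul, mul_comm, zpow_mul, zpow_natCast]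
    refine ⟨(Subgroup.zpowers (c ^ m)).topologicalClosure, fun x hx => ?_,
      hPc.of_isClosed_subset (Subgroup.isClosed_topologicalClosure _) hsub, fun hbot => ?_⟩
    · obtain ⟨z, hz, rfl⟩ := hsub hx
      exact ⟨V.pow_mem (hZV hz) m, hpow z (hZV hz)⟩
    · have h1 : c ^ m ∈ (⊥ : Subgroup T) := by
        rw [← hbot]
        exact Subgroup.le_topologicalClosure _ (Subgroup.mem_zpowers _)
      rw [Subgroup.mem_bot] at h1
      exact hfin (isOfFinOrder_iff_pow_eq_one.mpr ⟨m, Nat.factorial_pos _, h1⟩)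

end Elementary

/-! ### Pro-`Σ` groups: two closure properties -/

section ProSigma

variable {S : Set ℕ} {K : Type*} [Group K] [TopologicalSpace K]
  {K' : Type*} [Group K'] [TopologicalSpace K']

/-- Pro-`Σ` passes to continuous homomorphic images. [cite: Mochizuki2012, §2 p.44] -/
theorem isProSigma_of_surjective (hK : IsProSigma S K) (e : K →* K') (he : Continuous e)
    (hs : Function.Surjective e) : IsProSigma S K' := by
  refine ⟨fun N' hfin p hp hdvd => ?_⟩
  let N : OpenNormalSubgroup K :=
    { toSubgroup := N'.toSubgroup.comap e
      isOpen' := N'.isOpen'.preimage he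
      isNormal' := inferInstance }
  have hker : ((QuotientGroup.mk' N'.toSubgroup).comp e).ker = N.toSubgroup := by
    rw [← MonoidHom.comap_ker, QuotientGroup.ker_mk']
  have hsurj : Function.Surjective ((QuotientGroup.mk' N'.toSubgroup).comp e) :=
    (QuotientGroup.mk'_surjective _).comp hs
  have hequiv : K ⧸ N.toSubgroup ≃ K' ⧸ N'.toSubgroup := by
    rw [← hker]
    exact (QuotientGroup.quotientKerEquivOfSurjective _ hsurj).toEquiv
  haveI : Finite (K ⧸ N.toSubgroup) := Finite.of_equiv _ hequiv.symm
  refine hK.prime_mem N inferInstance p hp ?_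
  rw [Nat.card_congr hequiv]
  exact hdvd

/-- An open subgroup of a compact pro-`Σ` group is pro-`Σ`. [cite: Mochizuki2012, §2 p.51] -/
theorem isProSigma_subgroup_of_isOpen [IsTopologicalGroup K] [CompactSpace K]
    (hK : IsProSigma S K) (W : Subgroup K) (hW : IsOpen (W : Set K)) : IsProSigma S W := by
  refine ⟨fun N _ p hp hdvd => ?_⟩
  -- the image `N₁` of `N` in `K` is an open subgroup; it contains an open normal subgroup `H` of `K`
  have hN₁ : IsOpen ((N.toSubgroup.map W.subtype : Subgroup K) : Set K) := by
    have e : ((N.toSubgroup.map W.subtype : Subgroup K) : Set K) = Subtype.val '' (N : Set W) := by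
      ext x
      simp only [Subgroup.coe_map, Subgroup.coe_subtype, Set.mem_image, SetLike.mem_coe]
      rfl
    rw [e]
    exact hW.isOpenMap_subtype_val _ N.isOpen'
  obtain ⟨H, hH⟩ := IsTopologicalGroup.exist_openNormalSubgroup_sub_clopen_nhds_of_one
    (OpenSubgroup.isClopen ⟨_, hN₁⟩) (one_mem _)
  haveI : Finite (K ⧸ H.toSubgroup) := Subgroup.quotient_finite_of_isOpen _ H.isOpen'
  refine hK.prime_mem H inferInstance p hp (hdvd.trans ?_)
  have hle : H.toSubgroup ≤ N.toSubgroup.map W.subtype := fun x hx => hH hx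
  calc Nat.card (W ⧸ N.toSubgroup) = N.toSubgroup.index := rfl
    _ ∣ (N.toSubgroup.map W.subtype).index := by
        rw [Subgroup.index_map_subtype]; exact Dvd.intro _ rfl
    _ ∣ H.toSubgroup.index := Subgroup.index_dvd_of_le hle
    _ = Nat.card (K ⧸ H.toSubgroup) := rfl

/-- Any subgroup of a profinite pro-`Σ` group is pro-`Σ` (for the subspace topology: its open
normal subgroups of finite index are traces of open normal subgroups of the ambient group).
[cite: Mochizuki2012, §2 p.51] -/
theorem isProSigma_subgroup [IsTopologicalGroup K] [CompactSpace K] [TotallyDisconnectedSpace K]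
    (hK : IsProSigma S K) (Z : Subgroup K) : IsProSigma S Z := by
  refine ⟨fun U _ p hp hdvd => ?_⟩
  -- `U` is open in `Z`: `U = Z ∩ O` with `O ⊆ K` open, `1 ∈ O`; shrink `O` to an open normal `H`
  obtain ⟨O, hO, hOU⟩ : ∃ O : Set K, IsOpen O ∧ Subtype.val ⁻¹' O = (U : Set Z) :=
    isOpen_induced_iff.mp U.isOpen'
  have h1O : (1 : K) ∈ O := by
    have h1 : (1 : Z) ∈ Subtype.val ⁻¹' O := by rw [hOU]; exact one_mem U
    exact h1
  obtain ⟨H, hH⟩ := ProfiniteGrp.exist_openNormalSubgroup_sub_open_nhds_of_one hO h1O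
  have hle : H.toSubgroup.subgroupOf Z ≤ U.toSubgroup := by
    intro z hz
    have hz' : z ∈ Subtype.val ⁻¹' O := hH hz
    rw [hOU] at hz'
    exact hz'
  haveI : Finite (K ⧸ H.toSubgroup) := Subgroup.quotient_finite_of_isOpen _ H.isOpen'
  refine hK.prime_mem H inferInstance p hp (hdvd.trans ?_)
  calc Nat.card (Z ⧸ U.toSubgroup) = U.toSubgroup.index := rfl
    _ ∣ (H.toSubgroup.subgroupOf Z).index := Subgroup.index_dvd_of_le hle
    _ ∣ H.toSubgroup.index := Subgroup.relIndex_dvd_index_of_normal _ _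
    _ = Nat.card (K ⧸ H.toSubgroup) := rfl

/-- The canonical isomorphism `H.subgroupOf K ≃* H` (`H ≤ K`) is continuous for the subspace
topologies (private plumbing). [folklore] -/
private theorem continuous_subgroupOfEquivOfLe {T : Type*} [Group T] [TopologicalSpace T]
    {H K : Subgroup T} (h : H ≤ K) : Continuous (Subgroup.subgroupOfEquivOfLe h) := by
  refine continuous_induced_rng.2 ?_
  have e : (Subtype.val ∘ ⇑(Subgroup.subgroupOfEquivOfLe h)) = fun g : H.subgroupOf K => ((g : K) : T) := by
    funext g
    rfl
  rw [e]
  exact continuous_subtype_val.comp continuous_subtype_val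

/-- In the situation of `inf_isCompact_of_finiteIndex`, if `V` is moreover pro-`Σ`, so is `V ∩ N`
("the open subgroups of a pro-`Σ` Sylow subgroup", p. 51). [cite: Mochizuki2012, Prop 2.4(iii) p.51] -/
theorem isProSigma_inf_of_isOpen {T : Type*} [Group T] [TopologicalSpace T]
    [IsTopologicalGroup T] {V : Subgroup T} (hVc : IsCompact (V : Set T)) (hVS : IsProSigma S V)
    (N : Subgroup T) (hopen : IsOpen (((V ⊓ N).subgroupOf V : Subgroup V) : Set V)) :
    IsProSigma S ↥(V ⊓ N) := by
  haveI : CompactSpace V := isCompact_iff_compactSpace.mp hVc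
  exact isProSigma_of_surjective (isProSigma_subgroup_of_isOpen hVS _ hopen)
    (Subgroup.subgroupOfEquivOfLe (inf_le_left : V ⊓ N ≤ V)).toMonoidHom
    (continuous_subgroupOfEquivOfLe _) (Subgroup.subgroupOfEquivOfLe _).surjective

end ProSigma

/-! ### Proposition 2.2 from Proposition 2.1 with the elementary verticial hypothesis (p. 45) -/

namespace TemperedGraphGroupData

variable (D : TemperedGraphGroupData.{u})

/-- **Prop. 2.2, "in particular", from Prop. 2.1** — as `tp_isCommensurablyTerminal_of_prop21`, but
the verticial subgroup `V ⊆ Π^tp_𝔾` is only required to be an infinite compact subgroup (for `Π^tp_𝔾`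
Hausdorff): the nontrivial compact `Λ ⊆ V ∩ N` fed to Prop. 2.1 comes from
`exists_compact_le_inf_of_finiteIndex`, not from [NS]. [cite: Mochizuki2012, Prop 2.2 p.45] -/
theorem tp_isCommensurablyTerminal_of_prop21' [T2Space D.Tp]
    (h : D.ProfiniteConjugatesOfCompactSubgroups)
    (hV : ∃ V : Subgroup D.Tp, IsCompact (V : Set D.Tp) ∧ (V : Set D.Tp).Infinite) :
    IsCommensurablyTerminal D.ι.range := by
  obtain ⟨V, hVc, hVinf⟩ := hV
  refine ⟨isCommensurablyTerminal_of_le fun γ hγ => ?_⟩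
  have hγ' : γ⁻¹ ∈ Subgroup.Commensurable.commensurator D.ι.range := inv_mem hγ
  rw [Subgroup.Commensurable.commensurator_mem_iff] at hγ'
  set N : Subgroup D.Tp := (ConjAct.toConjAct γ⁻¹ • D.ι.range).comap D.ι with hN
  haveI hNfi : N.FiniteIndex := ⟨by rw [hN, Subgroup.index_comap]; exact hγ'.1⟩
  obtain ⟨Λ, hΛle, hΛc, hΛne⟩ := exists_compact_le_inf_of_finiteIndex hVc hVinf N
  refine h.mem_of_conj_le Λ hΛc hΛne γ fun l hl => ?_
  have hl' : D.ι l ∈ ConjAct.toConjAct γ⁻¹ • D.ι.range := (hΛle hl).2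
  rw [Subgroup.mem_pointwise_smul_iff_inv_smul_mem, ← ConjAct.toConjAct_inv, inv_inv,
    ConjAct.toConjAct_smul] at hl'
  exact hl'

/-- **Prop. 2.2 from Prop. 2.1** — as `prop22_of_prop21`, with the elementary verticial
hypothesis of `tp_isCommensurablyTerminal_of_prop21'`. [cite: Mochizuki2012, Prop 2.2 p.45] -/
theorem prop22_of_prop21' [T2Space D.Tp] (h21 : D.ProfiniteConjugatesOfCompactSubgroups)
    (hV : ∃ V : Subgroup D.Tp, IsCompact (V : Set D.Tp) ∧ (V : Set D.Tp).Infinite)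
    (hH : IsCommensurablyTerminal ((D.TpH.map D.ι).subgroupOf D.HatH))
    (hHatH : IsCommensurablyTerminal D.HatH)
    (hcl : (D.TpH.map D.ι).topologicalClosure = D.HatH) :
    D.CommensuratorsOfDecompositionSubgroups where
  hatH := hHatH
  tpH_in_hat := D.tpH_in_hat_of_closure hH hHatH hcl
  tpH_in_tp := D.tpH_in_tp_of_tpH_in_hat (D.tpH_in_hat_of_closure hH hHatH hcl)
  tp_in_hat := D.tp_isCommensurablyTerminal_of_prop21' h21 hV

end TemperedGraphGroupData

/-! ### Proposition 2.4 (iii) from Proposition 2.4 (i) (p. 51) -/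

namespace StableCurveTemperedData

variable (D : StableCurveTemperedData.{u})

/-- **Prop. 2.4 (iii), the `Δ`-statement, from Prop. 2.4 (i)** (proof, p. 51: "Just as in the proof
of Proposition 2.2, the commensurable terminality of `Δ^tp_X` in `Δ̂_X` follows immediately from
assertion (i), by allowing, in assertion (i), `Λ` to range over the open subgroups of a pro-`Σ`
Sylow subgroup of a decomposition group `⊆ Δ^tp_X` associated to an irreducible component of the
special fiber of `𝔛`").  That pro-`Σ` Sylow subgroup enters as the hypothesis `hV`: an infinite
compact pro-`Σ` subgroup `V ⊆ Δ^tp_X` all of whose finite index subgroups are open [(O3), p. 56].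
[cite: Mochizuki2012, Prop 2.4(iii) p.51] -/
theorem delta_isCommensurablyTerminal_of_prop24i (h : D.Prop24i)
    (hV : ∃ V : Subgroup D.DeltaTp, IsCompact (V : Set D.DeltaTp) ∧
      (V : Set D.DeltaTp).Infinite ∧ IsProSigma D.graph.Sigma V ∧
      ∀ W : Subgroup ↥V, W.FiniteIndex → IsOpen (W : Set ↥V)) :
    IsCommensurablyTerminal D.ιΔ.range := by
  obtain ⟨V, hVc, hVinf, hVS, hVopen⟩ := hV
  refine ⟨isCommensurablyTerminal_of_le fun γ hγ => ?_⟩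
  have hγ' : γ⁻¹ ∈ Subgroup.Commensurable.commensurator D.ιΔ.range := inv_mem hγ
  rw [Subgroup.Commensurable.commensurator_mem_iff] at hγ'
  set N : Subgroup D.DeltaTp := (ConjAct.toConjAct γ⁻¹ • D.ιΔ.range).comap D.ιΔ with hN
  haveI hNfi : N.FiniteIndex := ⟨by rw [hN, Subgroup.index_comap]; exact hγ'.1⟩
  obtain ⟨hΛc, hΛne, hΛopen⟩ := inf_isCompact_of_finiteIndex hVc hVinf hVopen N
  have hΛS : IsProSigma D.graph.Sigma ↥(V ⊓ N) := isProSigma_inf_of_isOpen hVc hVS N hΛopen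
  -- apply Proposition 2.4 (i) to `Λ := V ∩ N` and `γ ∈ Δ̂_X ⊆ Π̂_X`
  have hmem : (γ : D.PiHat) ∈ D.ιX.range := by
    refine h.mem_of_conj_le (V ⊓ N) hΛc hΛne hΛS γ fun l hl => ?_
    have hl' : D.ιΔ l ∈ ConjAct.toConjAct γ⁻¹ • D.ιΔ.range := hl.2
    rw [Subgroup.mem_pointwise_smul_iff_inv_smul_mem, ← ConjAct.toConjAct_inv, inv_inv,
      ConjAct.toConjAct_smul] at hl'
    obtain ⟨d, hd⟩ := hl'
    refine ⟨(d : D.PiTp), d.2, ?_⟩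
    have hd' := congrArg (fun z : D.DeltaHat => (z : D.PiHat)) hd
    simpa only [coe_ιΔ, Subgroup.coe_mul, Subgroup.coe_inv] using hd'
  obtain ⟨t, ht⟩ := hmem
  have htΔ : t ∈ D.DeltaTp := by
    rw [MonoidHom.mem_ker, ← D.prHat_ιX, ht]; exact γ.2
  exact ⟨⟨t, htΔ⟩, Subtype.ext (by rw [coe_ιΔ]; exact ht)⟩

/-- **Prop. 2.4 (iii) from Prop. 2.4 (i)** and the pro-`Σ` Sylow subgroup `V` of a verticial
decomposition group (the whole printed proof of (iii), p. 51). [cite: Mochizuki2012, Prop 2.4(iii) p.51] -/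
theorem prop24iii_of_prop24i (h : D.Prop24i)
    (hV : ∃ V : Subgroup D.DeltaTp, IsCompact (V : Set D.DeltaTp) ∧
      (V : Set D.DeltaTp).Infinite ∧ IsProSigma D.graph.Sigma V ∧
      ∀ W : Subgroup ↥V, W.FiniteIndex → IsOpen (W : Set ↥V)) :
    D.Prop24iii :=
  D.prop24iii_of_delta (D.delta_isCommensurablyTerminal_of_prop24i h hV)

/-- **Prop. 2.4 (iii), the `Δ`-statement, from Prop. 2.4 (i)** — as
`delta_isCommensurablyTerminal_of_prop24i`, but the pro-`Σ` Sylow subgroup `V ⊆ Δ^tp_X` is only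
required to be an infinite PROFINITE (compact, totally disconnected) pro-`Σ` subgroup, `Π^tp_X`
Hausdorff: the nontrivial compact pro-`Σ` `Λ ⊆ V ∩ N` fed to Prop. 2.4 (i) comes from
`exists_compact_le_inf_of_finiteIndex` and `isProSigma_subgroup`, not from [NS].
[cite: Mochizuki2012, Prop 2.4(iii) p.51] -/
theorem delta_isCommensurablyTerminal_of_prop24i' [T2Space D.PiTp] (h : D.Prop24i)
    (hV : ∃ V : Subgroup D.DeltaTp, IsCompact (V : Set D.DeltaTp) ∧
      (V : Set D.DeltaTp).Infinite ∧ IsProSigma D.graph.Sigma V ∧ TotallyDisconnectedSpace V) :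
    IsCommensurablyTerminal D.ιΔ.range := by
  obtain ⟨V, hVc, hVinf, hVS, hVtd⟩ := hV
  refine ⟨isCommensurablyTerminal_of_le fun γ hγ => ?_⟩
  have hγ' : γ⁻¹ ∈ Subgroup.Commensurable.commensurator D.ιΔ.range := inv_mem hγ
  rw [Subgroup.Commensurable.commensurator_mem_iff] at hγ'
  set N : Subgroup D.DeltaTp := (ConjAct.toConjAct γ⁻¹ • D.ιΔ.range).comap D.ιΔ with hN
  haveI hNfi : N.FiniteIndex := ⟨by rw [hN, Subgroup.index_comap]; exact hγ'.1⟩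
  obtain ⟨Λ, hΛle, hΛc, hΛne⟩ := exists_compact_le_inf_of_finiteIndex hVc hVinf N
  -- `Λ ⊆ V` is pro-`Σ`: a subgroup of the profinite pro-`Σ` group `V`
  have hΛV : Λ ≤ V := fun x hx => (hΛle hx).1
  haveI : CompactSpace V := isCompact_iff_compactSpace.mp hVc
  have hΛS : IsProSigma D.graph.Sigma Λ :=
    isProSigma_of_surjective (isProSigma_subgroup hVS (Λ.subgroupOf V))
      (Subgroup.subgroupOfEquivOfLe hΛV).toMonoidHom (continuous_subgroupOfEquivOfLe hΛV)
      (Subgroup.subgroupOfEquivOfLe hΛV).surjective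
  -- apply Proposition 2.4 (i) to `Λ` and `γ ∈ Δ̂_X ⊆ Π̂_X`
  have hmem : (γ : D.PiHat) ∈ D.ιX.range := by
    refine h.mem_of_conj_le Λ hΛc hΛne hΛS γ fun l hl => ?_
    have hl' : D.ιΔ l ∈ ConjAct.toConjAct γ⁻¹ • D.ιΔ.range := (hΛle hl).2
    rw [Subgroup.mem_pointwise_smul_iff_inv_smul_mem, ← ConjAct.toConjAct_inv, inv_inv,
      ConjAct.toConjAct_smul] at hl'
    obtain ⟨d, hd⟩ := hl'
    refine ⟨(d : D.PiTp), d.2, ?_⟩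
    have hd' := congrArg (fun z : D.DeltaHat => (z : D.PiHat)) hd
    simpa only [coe_ιΔ, Subgroup.coe_mul, Subgroup.coe_inv] using hd'
  obtain ⟨t, ht⟩ := hmem
  have htΔ : t ∈ D.DeltaTp := by
    rw [MonoidHom.mem_ker, ← D.prHat_ιX, ht]; exact γ.2
  exact ⟨⟨t, htΔ⟩, Subtype.ext (by rw [coe_ιΔ]; exact ht)⟩

/-- **Prop. 2.4 (iii) from Prop. 2.4 (i)** with the elementary (profinite, not [NS]) form of the
pro-`Σ` Sylow hypothesis. [cite: Mochizuki2012, Prop 2.4(iii) p.51] -/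
theorem prop24iii_of_prop24i' [T2Space D.PiTp] (h : D.Prop24i)
    (hV : ∃ V : Subgroup D.DeltaTp, IsCompact (V : Set D.DeltaTp) ∧
      (V : Set D.DeltaTp).Infinite ∧ IsProSigma D.graph.Sigma V ∧ TotallyDisconnectedSpace V) :
    D.Prop24iii :=
  D.prop24iii_of_delta (D.delta_isCommensurablyTerminal_of_prop24i' h hV)

end StableCurveTemperedData

end Literature.IUT.HodgeTheaters
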